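import Mathlib.RingTheory.Henselian
import Mathlib.RingTheory.LocalRing.ResidueField.Basic
import Mathlib.Algebra.CharP.Lemmas
import Mathlib.Data.Nat.Factorization.Basic
import Mathlib.Data.Int.GCD
import Mathlib.GroupTheory.OrderOfElement
import HarnessLib

/-!
# Teichmüller representatives and the principal part `x = ω(x)·⟨x⟩` in a Henselian local ring with finite residue ring

Serre, *Local Fields* (1979), Ch. II §4 Prop. 8 (the multiplicative system of representatives of a complete discrete valuation
ring with perfect residue field of characteristic `p`: every unit `x` is uniquely `x = ω(x)·u` with `ω(x)` a root of unity of order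
prime to `p` and `u ≡ 1 mod 𝔪`); Neukirch, *Algebraic Number Theory* (1999), Ch. II (4.4)/(5.3) (`U = μ_{q−1} × U⁽¹⁾`).

We isolate the ring-theoretic content with the weakest hypotheses the Lubin–Tate files of the tree can supply (the unit ball `𝒪_E` of a
finite extension `E` of a local field `F` is `(π)`-adically complete — hence Henselian at `(π)` — and `𝒪_E/π𝒪_E` is finite):

* §1 (any local ring `R`) `IsTeichmullerRep ζ x` — `ζ` is a root of unity of order invertible in `R` with `ζ ≡ x mod 𝔪`;
  ★ `IsTeichmullerRep.unique` — two such `ζ` for the same `x` are EQUAL (a simple root of `X^N − 1` is determined by its residue,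
  Mathlib `IsLocalRing.eq_of_eval_eq_zero_of_not_isUnit_sub`); `teichmullerRep x` (the representative, by choice, `1` if none),
  `principalPart x := x · ω(x)⁻¹`; their algebra: `teichmullerRep_eq`, `isUnit_teichmullerRep`, ★ `principalPart_sub_one_mem`,
  ★ `teichmullerRep_mul` / `principalPart_mul`, ★ `map_teichmullerRep` / `map_principalPart` (local homomorphisms),
  `teichmullerRep_eq_self`, `principalPart_eq_self`, `teichmullerRep_one`, `principalPart_one`;
* §2 (EXISTENCE) ★★ `exists_isTeichmullerRep` — if `R` is Henselian at an ideal `I` containing a rational prime `p` and `R/I` is finite,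
  every unit `x` has a Teichmüller representative: `#(R/I)ˣ = p^s·n` with `p ∤ n`, Hensel lifts the root `x^{p^s}` of `X^n − 1` modulo `I`
  to `ζ₀`, and `ζ := ζ₀^t` with `p^s t ≡ 1 mod n` satisfies `ζ ≡ x mod 𝔪` (Frobenius is injective on the residue field);
  `charP_residueField_of_mem`, `isUnit_natCast_of_coprime`.

Everything PROVED (0 sorry); two definitions (`teichmullerRep`, `principalPart`) and one `Prop`-valued predicate.

## References
* [SerreLocalFields1979] J.-P. Serre, *Local Fields* (1979), Ch. II §4 Prop. 8, Ch. IV §1.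
* [NeukirchANT1999] J. Neukirch, *Algebraic Number Theory* (1999), Ch. II (4.4), (5.3).
-/

noncomputable section

open IsLocalRing Polynomial

namespace Literature.RingTheory.CompleteLocalRings

/-- `a ∣ b`, `a ∈ I` ⟹ `b ∈ I`. [folklore] -/
private theorem mem_of_dvd_of_mem' {R : Type*} [CommRing R] {I : Ideal R} {a b : R} (h : a ∣ b) (ha : a ∈ I) : b ∈ I := by
  obtain ⟨c, rfl⟩ := h
  exact I.mul_mem_right c ha

/-! ### §1. Teichmüller representatives in a local ring: uniqueness and algebra -/

section LocalRing

variable {R : Type*} [CommRing R] [IsLocalRing R]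

/-- **`ζ` is a Teichmüller representative of `x`**: `ζ^N = 1` for some `N` invertible in `R` (a root of unity of order prime to the
residue characteristic) and `ζ ≡ x (mod 𝔪)`. [cite: SerreLocalFields1979, Ch. II §4 Prop. 8] -/
def IsTeichmullerRep (ζ x : R) : Prop :=
  (∃ N : ℕ, IsUnit (N : R) ∧ ζ ^ N = 1) ∧ ζ - x ∈ maximalIdeal R

omit [IsLocalRing R] in
/-- A root of unity of order `N` with `N` invertible is a unit (`N ≠ 0`). [cite: SerreLocalFields1979, Ch. II §4 Prop. 8] -/
theorem isUnit_of_pow_eq_one_of_isUnit_natCast [Nontrivial R] {ζ : R} {N : ℕ} (hN : IsUnit (N : R)) (hζ : ζ ^ N = 1) :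
    IsUnit ζ := by
  have hN0 : N ≠ 0 := by rintro rfl; rw [Nat.cast_zero] at hN; exact not_isUnit_zero hN
  exact IsUnit.of_pow_eq_one hζ hN0

/-- ★ **Uniqueness**: two roots of unity of orders invertible in `R` which are congruent modulo `𝔪` are equal — `ζ₁` is a SIMPLE root
of `X^{N₁N₂} − 1` (derivative `N₁N₂·ζ₁^{N₁N₂−1}`, a unit), and a simple root is determined by its residue class.
[cite: SerreLocalFields1979, Ch. II §4 Prop. 8] -/
theorem eq_of_pow_eq_one_of_sub_mem_maximalIdeal {ζ₁ ζ₂ : R} {N₁ N₂ : ℕ} (hN₁ : IsUnit (N₁ : R)) (h₁ : ζ₁ ^ N₁ = 1)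
    (hN₂ : IsUnit (N₂ : R)) (h₂ : ζ₂ ^ N₂ = 1) (h : ζ₁ - ζ₂ ∈ maximalIdeal R) : ζ₁ = ζ₂ := by
  set N := N₁ * N₂ with hN
  have hNu : IsUnit (N : R) := by rw [hN, Nat.cast_mul]; exact hN₁.mul hN₂
  have hζ₁ : ζ₁ ^ N = 1 := by rw [hN, pow_mul, h₁, one_pow]
  have hζ₂ : ζ₂ ^ N = 1 := by rw [hN, mul_comm, pow_mul, h₂, one_pow]
  have hN0 : N ≠ 0 := by rintro h0; rw [h0, Nat.cast_zero] at hNu; exact not_isUnit_zero hNu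
  set f : R[X] := X ^ N - C 1 with hf
  have hev : ∀ z : R, f.eval z = z ^ N - 1 := fun z => by rw [hf, eval_sub, eval_pow, eval_X, eval_C]
  have hder : ∀ z : R, f.derivative.eval z = (N : R) * z ^ (N - 1) := fun z => by
    rw [hf, derivative_sub, derivative_X_pow, derivative_C, sub_zero, eval_mul, eval_C, eval_pow, eval_X]
  refine IsLocalRing.eq_of_eval_eq_zero_of_not_isUnit_sub (f := f) (by rw [hev, hζ₁, sub_self]) (by rw [hev, hζ₂, sub_self])
    (fun hu => (IsLocalRing.mem_maximalIdeal _).mp h hu) ?_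
  rw [hder]
  exact hNu.mul ((IsUnit.of_pow_eq_one hζ₁ hN0).pow _)

/-- ★ Two Teichmüller representatives of the same `x` coincide. [cite: SerreLocalFields1979, Ch. II §4 Prop. 8] -/
theorem IsTeichmullerRep.unique {ζ₁ ζ₂ x : R} (h₁ : IsTeichmullerRep ζ₁ x) (h₂ : IsTeichmullerRep ζ₂ x) : ζ₁ = ζ₂ := by
  obtain ⟨⟨N₁, hN₁, hζ₁⟩, hx₁⟩ := h₁
  obtain ⟨⟨N₂, hN₂, hζ₂⟩, hx₂⟩ := h₂
  refine eq_of_pow_eq_one_of_sub_mem_maximalIdeal hN₁ hζ₁ hN₂ hζ₂ ?_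
  have e : ζ₁ - ζ₂ = (ζ₁ - x) - (ζ₂ - x) := by ring
  rw [e]
  exact Ideal.sub_mem _ hx₁ hx₂

/-- A Teichmüller representative of `x` is also one of every `y ≡ x (mod 𝔪)`. [cite: SerreLocalFields1979, Ch. II §4 Prop. 8] -/
theorem IsTeichmullerRep.of_sub_mem {ζ x y : R} (h : IsTeichmullerRep ζ x) (hxy : x - y ∈ maximalIdeal R) : IsTeichmullerRep ζ y := by
  refine ⟨h.1, ?_⟩
  have e : ζ - y = (ζ - x) + (x - y) := by ring
  rw [e]
  exact Ideal.add_mem _ h.2 hxy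

/-- The product of Teichmüller representatives represents the product. [cite: SerreLocalFields1979, Ch. II §4 Prop. 8] -/
theorem IsTeichmullerRep.mul {ζ ζ' x x' : R} (h : IsTeichmullerRep ζ x) (h' : IsTeichmullerRep ζ' x') :
    IsTeichmullerRep (ζ * ζ') (x * x') := by
  obtain ⟨⟨N, hN, hζ⟩, hx⟩ := h
  obtain ⟨⟨N', hN', hζ'⟩, hx'⟩ := h'
  refine ⟨⟨N * N', by rw [Nat.cast_mul]; exact hN.mul hN', ?_⟩, ?_⟩
  · rw [mul_pow, pow_mul, hζ, one_pow, one_mul, mul_comm N, pow_mul, hζ', one_pow]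
  · have e : ζ * ζ' - x * x' = ζ * (ζ' - x') + (ζ - x) * x' := by ring
    rw [e]
    exact Ideal.add_mem _ (Ideal.mul_mem_left _ _ hx') (Ideal.mul_mem_right _ _ hx)

/-- A root of unity of invertible order represents itself. [cite: SerreLocalFields1979, Ch. II §4 Prop. 8] -/
theorem IsTeichmullerRep.self {ζ : R} {N : ℕ} (hN : IsUnit (N : R)) (hζ : ζ ^ N = 1) : IsTeichmullerRep ζ ζ :=
  ⟨⟨N, hN, hζ⟩, by rw [sub_self]; exact Ideal.zero_mem _⟩

/-- `1` represents every principal unit `u ≡ 1 (mod 𝔪)`. [cite: SerreLocalFields1979, Ch. IV §1] -/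
theorem IsTeichmullerRep.one_of_sub_one_mem {u : R} (hu : u - 1 ∈ maximalIdeal R) : IsTeichmullerRep 1 u :=
  ⟨⟨1, by rw [Nat.cast_one]; exact isUnit_one, one_pow 1⟩, by rw [← Ideal.neg_mem_iff, neg_sub]; exact hu⟩

/-- **Local homomorphisms preserve Teichmüller representatives** (`φ(𝔪_R) ⊆ 𝔪_S`). [cite: SerreLocalFields1979, Ch. II §4 Prop. 8] -/
theorem IsTeichmullerRep.map {S : Type*} [CommRing S] [IsLocalRing S] (φ : R →+* S)
    (hφ : ∀ a ∈ maximalIdeal R, φ a ∈ maximalIdeal S) {ζ x : R} (h : IsTeichmullerRep ζ x) :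
    IsTeichmullerRep (φ ζ) (φ x) := by
  obtain ⟨⟨N, hN, hζ⟩, hx⟩ := h
  exact ⟨⟨N, by rw [← map_natCast φ]; exact hN.map φ, by rw [← map_pow, hζ, map_one]⟩, by rw [← map_sub]; exact hφ _ hx⟩

open scoped Classical in
/-- **The Teichmüller representative `ω(x)`** of `x` (the unique root of unity of invertible order congruent to `x` modulo `𝔪`, when one
exists; `1` otherwise). [cite: SerreLocalFields1979, Ch. II §4 Prop. 8] -/
def teichmullerRep (x : R) : R :=
  if h : ∃ ζ : R, IsTeichmullerRep ζ x then h.choose else 1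

/-- When a representative exists, `ω(x)` is one. [cite: SerreLocalFields1979, Ch. II §4 Prop. 8] -/
theorem isTeichmullerRep_teichmullerRep {x : R} (h : ∃ ζ : R, IsTeichmullerRep ζ x) : IsTeichmullerRep (teichmullerRep x) x := by
  classical
  rw [teichmullerRep, dif_pos h]
  exact h.choose_spec

/-- ★ `ω(x) = ζ` for every Teichmüller representative `ζ` of `x` (uniqueness). [cite: SerreLocalFields1979, Ch. II §4 Prop. 8] -/
theorem teichmullerRep_eq {ζ x : R} (h : IsTeichmullerRep ζ x) : teichmullerRep x = ζ :=
  (isTeichmullerRep_teichmullerRep ⟨ζ, h⟩).unique h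

/-- `ω(x)` is a root of unity of invertible order (or `1`), hence a unit. [cite: SerreLocalFields1979, Ch. II §4 Prop. 8] -/
theorem exists_isUnit_natCast_and_teichmullerRep_pow_eq_one (x : R) :
    ∃ N : ℕ, IsUnit (N : R) ∧ teichmullerRep x ^ N = 1 := by
  classical
  by_cases h : ∃ ζ : R, IsTeichmullerRep ζ x
  · exact (isTeichmullerRep_teichmullerRep h).1
  · refine ⟨1, by rw [Nat.cast_one]; exact isUnit_one, ?_⟩
    rw [teichmullerRep, dif_neg h, one_pow]

/-- `ω(x)` is a unit. [cite: SerreLocalFields1979, Ch. II §4 Prop. 8] -/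
theorem isUnit_teichmullerRep (x : R) : IsUnit (teichmullerRep x) := by
  obtain ⟨N, hN, h⟩ := exists_isUnit_natCast_and_teichmullerRep_pow_eq_one x
  exact isUnit_of_pow_eq_one_of_isUnit_natCast hN h

/-- **The principal part `⟨x⟩ := x·ω(x)⁻¹`** of `x`. [cite: SerreLocalFields1979, Ch. II §4 Prop. 8] [cite: NeukirchANT1999, Ch. II (5.3)] -/
def principalPart (x : R) : R :=
  x * ↑(isUnit_teichmullerRep x).unit⁻¹

/-- `x = ω(x)·⟨x⟩`. [cite: SerreLocalFields1979, Ch. II §4 Prop. 8] -/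
theorem teichmullerRep_mul_principalPart (x : R) : teichmullerRep x * principalPart x = x := by
  rw [principalPart, mul_left_comm, IsUnit.mul_val_inv, mul_one]

/-- `⟨x⟩·ω(x) = x`. [cite: SerreLocalFields1979, Ch. II §4 Prop. 8] -/
theorem principalPart_mul_teichmullerRep (x : R) : principalPart x * teichmullerRep x = x := by
  rw [mul_comm, teichmullerRep_mul_principalPart]

/-- ★ **`⟨x⟩ ≡ 1 (mod 𝔪)`** whenever `x` has a Teichmüller representative. [cite: SerreLocalFields1979, Ch. II §4 Prop. 8] -/
theorem principalPart_sub_one_mem {x : R} (h : ∃ ζ : R, IsTeichmullerRep ζ x) :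
    principalPart x - 1 ∈ maximalIdeal R := by
  have hrep := isTeichmullerRep_teichmullerRep h
  have e : principalPart x - 1 = -((teichmullerRep x - x) * ↑(isUnit_teichmullerRep x).unit⁻¹) := by
    rw [principalPart, sub_mul, IsUnit.mul_val_inv]; ring
  rw [e, Ideal.neg_mem_iff]
  exact Ideal.mul_mem_right _ _ hrep.2

/-- `⟨x⟩` is a unit when `x` is. [cite: SerreLocalFields1979, Ch. II §4 Prop. 8] -/
theorem isUnit_principalPart {x : R} (hx : IsUnit x) : IsUnit (principalPart x) := by
  rw [principalPart]; exact hx.mul (Units.isUnit _)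

/-- ★ **`ω(xy) = ω(x)ω(y)`** when both factors have representatives. [cite: SerreLocalFields1979, Ch. II §4 Prop. 8] -/
theorem teichmullerRep_mul {x y : R} (hx : ∃ ζ : R, IsTeichmullerRep ζ x) (hy : ∃ ζ : R, IsTeichmullerRep ζ y) :
    teichmullerRep (x * y) = teichmullerRep x * teichmullerRep y :=
  teichmullerRep_eq ((isTeichmullerRep_teichmullerRep hx).mul (isTeichmullerRep_teichmullerRep hy))

/-- ★ **`⟨xy⟩ = ⟨x⟩⟨y⟩`** when both factors have representatives. [cite: SerreLocalFields1979, Ch. II §4 Prop. 8] -/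
theorem principalPart_mul {x y : R} (hx : ∃ ζ : R, IsTeichmullerRep ζ x) (hy : ∃ ζ : R, IsTeichmullerRep ζ y) :
    principalPart (x * y) = principalPart x * principalPart y := by
  have hu := isUnit_teichmullerRep (x * y)
  -- cancel `ω(xy) = ω(x)ω(y)` on the left
  refine hu.mul_left_cancel ?_
  rw [teichmullerRep_mul_principalPart, teichmullerRep_mul hx hy, mul_mul_mul_comm, teichmullerRep_mul_principalPart,
    teichmullerRep_mul_principalPart]

/-- `ω(x)` depends only on `x mod 𝔪`. [cite: SerreLocalFields1979, Ch. II §4 Prop. 8] -/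
theorem teichmullerRep_congr {x y : R} (hx : ∃ ζ : R, IsTeichmullerRep ζ x) (hxy : x - y ∈ maximalIdeal R) :
    teichmullerRep y = teichmullerRep x :=
  teichmullerRep_eq ((isTeichmullerRep_teichmullerRep hx).of_sub_mem hxy)

/-- `ω(ζ) = ζ` for a root of unity of invertible order. [cite: SerreLocalFields1979, Ch. II §4 Prop. 8] -/
theorem teichmullerRep_eq_self {ζ : R} {N : ℕ} (hN : IsUnit (N : R)) (hζ : ζ ^ N = 1) : teichmullerRep ζ = ζ :=
  teichmullerRep_eq (IsTeichmullerRep.self hN hζ)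

/-- `ω(u) = 1` for a principal unit `u ≡ 1 (mod 𝔪)`. [cite: SerreLocalFields1979, Ch. IV §1] -/
theorem teichmullerRep_eq_one_of_sub_one_mem {u : R} (hu : u - 1 ∈ maximalIdeal R) : teichmullerRep u = 1 :=
  teichmullerRep_eq (IsTeichmullerRep.one_of_sub_one_mem hu)

/-- `⟨u⟩ = u` for a principal unit. [cite: SerreLocalFields1979, Ch. IV §1] -/
theorem principalPart_eq_self_of_sub_one_mem {u : R} (hu : u - 1 ∈ maximalIdeal R) : principalPart u = u := by
  have h := teichmullerRep_mul_principalPart u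
  rwa [teichmullerRep_eq_one_of_sub_one_mem hu, one_mul] at h

/-- `ω(1) = 1`. [cite: SerreLocalFields1979, Ch. II §4 Prop. 8] -/
theorem teichmullerRep_one : teichmullerRep (1 : R) = 1 :=
  teichmullerRep_eq_one_of_sub_one_mem (by rw [sub_self]; exact Ideal.zero_mem _)

/-- `⟨1⟩ = 1`. [cite: SerreLocalFields1979, Ch. II §4 Prop. 8] -/
theorem principalPart_one : principalPart (1 : R) = 1 :=
  principalPart_eq_self_of_sub_one_mem (by rw [sub_self]; exact Ideal.zero_mem _)

/-- `⟨ζ⟩ = 1` for a root of unity of invertible order. [cite: SerreLocalFields1979, Ch. II §4 Prop. 8] -/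
theorem principalPart_eq_one_of_pow_eq_one {ζ : R} {N : ℕ} (hN : IsUnit (N : R)) (hζ : ζ ^ N = 1) :
    principalPart ζ = 1 := by
  have h := teichmullerRep_mul_principalPart ζ
  rw [teichmullerRep_eq_self hN hζ] at h
  exact (isUnit_of_pow_eq_one_of_isUnit_natCast hN hζ).mul_left_cancel (h.trans (mul_one ζ).symm)

/-- ★ **Local homomorphisms commute with `ω`**: `φ(ω(x)) = ω(φ x)` when `x` has a representative.
[cite: SerreLocalFields1979, Ch. II §4 Prop. 8] -/
theorem map_teichmullerRep {S : Type*} [CommRing S] [IsLocalRing S] (φ : R →+* S)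
    (hφ : ∀ a ∈ maximalIdeal R, φ a ∈ maximalIdeal S) {x : R} (hx : ∃ ζ : R, IsTeichmullerRep ζ x) :
    φ (teichmullerRep x) = teichmullerRep (φ x) :=
  (teichmullerRep_eq ((isTeichmullerRep_teichmullerRep hx).map φ hφ)).symm

/-- ★ **Local homomorphisms commute with the principal part**: `φ⟨x⟩ = ⟨φ x⟩`. [cite: SerreLocalFields1979, Ch. II §4 Prop. 8] -/
theorem map_principalPart {S : Type*} [CommRing S] [IsLocalRing S] (φ : R →+* S)
    (hφ : ∀ a ∈ maximalIdeal R, φ a ∈ maximalIdeal S) {x : R} (hx : ∃ ζ : R, IsTeichmullerRep ζ x) :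
    φ (principalPart x) = principalPart (φ x) := by
  have hu := isUnit_teichmullerRep (φ x)
  refine hu.mul_left_cancel ?_
  rw [teichmullerRep_mul_principalPart, ← map_teichmullerRep φ hφ hx, ← map_mul, teichmullerRep_mul_principalPart]

end LocalRing

/-! ### §2. Existence in a Henselian local ring with finite residue ring -/

section Existence

variable {R : Type*} [CommRing R] [IsLocalRing R] (I : Ideal R) [HenselianRing R I] {p : ℕ} (hp : p.Prime) (hpI : (p : R) ∈ I)

include hpI in
/-- `I ≤ 𝔪` (the Jacobson radical of a local ring), so `p ∈ 𝔪`. [cite: SerreLocalFields1979, Ch. II §4] -/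
theorem natCast_mem_maximalIdeal_of_mem : (p : R) ∈ maximalIdeal R := by
  have hI : I ≤ maximalIdeal R := fun a ha =>
    (IsLocalRing.jacobson_eq_maximalIdeal (⊥ : Ideal R) bot_ne_top) ▸ HenselianRing.jac ha
  exact hI hpI

include I hp hpI in
/-- The residue field has characteristic `p`. [cite: SerreLocalFields1979, Ch. II §4] -/
theorem charP_residueField_of_mem : CharP (ResidueField R) p := by
  have h0 : (p : ResidueField R) = 0 := by
    rw [← map_natCast (residue R), residue_eq_zero_iff]
    exact natCast_mem_maximalIdeal_of_mem I hpI
  exact (CharP.charP_iff_prime_eq_zero hp).mpr h0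

include I hp hpI in
/-- A natural number prime to `p` is a unit of `R`. [cite: SerreLocalFields1979, Ch. II §4] -/
theorem isUnit_natCast_of_coprime {n : ℕ} (hn : p.Coprime n) : IsUnit (n : R) := by
  haveI := charP_residueField_of_mem I hp hpI
  rw [← residue_ne_zero_iff_isUnit, map_natCast, Ne, CharP.cast_eq_zero_iff (ResidueField R) p n]
  exact fun h => hp.ne_one ((Nat.coprime_iff_gcd_eq_one.mp hn) ▸ Nat.dvd_gcd (dvd_refl p) h |> Nat.dvd_one.mp)

include I hp hpI in
/-- In the residue field, `z^{p^s} = 1` forces `z = 1` (Frobenius is injective). [cite: SerreLocalFields1979, Ch. II §4 Lemma 1] -/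
theorem residue_eq_one_of_pow_prime_pow {z : R} {s : ℕ} (hz : z ^ p ^ s - 1 ∈ maximalIdeal R) : z - 1 ∈ maximalIdeal R := by
  haveI := charP_residueField_of_mem I hp hpI
  haveI : Fact p.Prime := ⟨hp⟩
  rw [← residue_eq_zero_iff, map_sub, map_one] at hz ⊢
  rw [map_pow] at hz
  have h : (residue R z - 1) ^ p ^ s = 0 := by rw [sub_pow_char_pow, one_pow]; exact hz
  exact pow_eq_zero_iff (pow_ne_zero s hp.ne_zero) |>.mp h

include hp hpI in
/-- ★★ **EXISTENCE of Teichmüller representatives**: if `R` is Henselian at an ideal `I ∋ p` with `R/I` finite, every unit `x` of `R`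
has a Teichmüller representative.  Proof: `Φ := #(R/I)ˣ = p^s·n` with `p ∤ n`; `x^Φ ≡ 1 (mod I)`, so `y := x^{p^s}` is a root of
`X^n − 1` modulo `I` with unit derivative; Hensel gives `ζ₀^n = 1`, `ζ₀ ≡ y (mod I)`; with `p^s·t ≡ 1 (mod n)`, `ζ := ζ₀^t` satisfies
`ζ^n = 1` and `ζ ≡ x^{p^s t} ≡ x (mod 𝔪)` — the last step because `(x^{p^s t − 1})^{p^s} = (x^Φ)^c ≡ 1` and Frobenius is injective on
`R/𝔪`. [cite: SerreLocalFields1979, Ch. II §4 Prop. 8] [cite: NeukirchANT1999, Ch. II (4.4)] -/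
theorem exists_isTeichmullerRep [Finite (R ⧸ I)] {x : R} (hx : IsUnit x) : ∃ ζ : R, IsTeichmullerRep ζ x := by
  classical
  haveI : Fact p.Prime := ⟨hp⟩
  letI : Fintype (R ⧸ I)ˣ := Fintype.ofFinite _
  have hI𝔪 : I ≤ maximalIdeal R := fun a ha =>
    (IsLocalRing.jacobson_eq_maximalIdeal (⊥ : Ideal R) bot_ne_top) ▸ HenselianRing.jac ha
  -- `Φ = #(R/I)ˣ`, `x^Φ ≡ 1 (mod I)`
  set Φ := Fintype.card (R ⧸ I)ˣ with hΦ
  have hΦ0 : Φ ≠ 0 := Fintype.card_ne_zero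
  have hxΦ : x ^ Φ - 1 ∈ I := by
    have hu : IsUnit (Ideal.Quotient.mk I x) := hx.map _
    have h1 : (hu.unit : (R ⧸ I)ˣ) ^ Φ = 1 := pow_card_eq_one
    have h2 : Ideal.Quotient.mk I (x ^ Φ) = Ideal.Quotient.mk I 1 := by
      rw [map_pow, map_one, ← hu.unit_spec, ← Units.val_pow_eq_pow_val, h1, Units.val_one]
    exact Ideal.Quotient.eq.mp h2
  -- `Φ = p^s · n`, `p ∤ n`
  set s := Φ.factorization p with hs
  set n := Φ / p ^ s with hn
  have hΦsn : p ^ s * n = Φ := Nat.ordProj_mul_ordCompl_eq_self Φ p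
  have hpn : p.Coprime n := Nat.coprime_ordCompl hp hΦ0
  have hn0 : n ≠ 0 := (Nat.ordCompl_pos p hΦ0).ne'
  have hnu : IsUnit (n : R) := isUnit_natCast_of_coprime I hp hpI hpn
  -- Hensel for `X^n − 1` at `y = x^{p^s}`
  set y := x ^ p ^ s with hy
  have hyn : y ^ n - 1 ∈ I := by rw [hy, ← pow_mul, hΦsn]; exact hxΦ
  set f : R[X] := X ^ n - C 1 with hf
  have hmonic : f.Monic := by
    rw [hf]; exact monic_X_pow_sub_C (1 : R) hn0
  have hev : ∀ z : R, f.eval z = z ^ n - 1 := fun z => by rw [hf, eval_sub, eval_pow, eval_X, eval_C]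
  have hder : ∀ z : R, f.derivative.eval z = (n : R) * z ^ (n - 1) := fun z => by
    rw [hf, derivative_sub, derivative_X_pow, derivative_C, sub_zero, eval_mul, eval_C, eval_pow, eval_X]
  have hyu : IsUnit y := hx.pow _
  obtain ⟨ζ₀, hζ₀root, hζ₀y⟩ := HenselianRing.is_henselian (I := I) f hmonic y (by rw [hev]; exact hyn)
    (by rw [hder]; exact (hnu.mul (hyu.pow _)).map _)
  have hζ₀n : ζ₀ ^ n = 1 := by
    have h := hζ₀root
    rw [IsRoot.def, hev, sub_eq_zero] at h
    exact h
  -- `t` with `p^s t ≡ 1 (mod n)`, `t ≥ 1`: write `p^s t = n c + 1`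
  obtain ⟨t₀, -, ht₀⟩ := Nat.exists_mul_mod_eq_of_coprime 1 (Nat.Coprime.pow_left s hpn) hn0
  set t := t₀ + n with ht
  have hmod : Nat.ModEq n (p ^ s * t) 1 := by
    change p ^ s * t % n = 1 % n
    rw [ht, mul_add, Nat.add_mul_mod_self_right, ht₀]
  have ht1 : 1 ≤ p ^ s * t := Nat.one_le_iff_ne_zero.mpr (mul_ne_zero (pow_ne_zero s hp.ne_zero) (by rw [ht]; exact (Nat.add_pos_right t₀ (Nat.pos_of_ne_zero hn0)).ne'))
  obtain ⟨c, hc⟩ := (Nat.modEq_iff_dvd' ht1).mp hmod.symm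
  have hpst : p ^ s * t = n * c + 1 := by omega
  -- the representative `ζ := ζ₀^t`
  refine ⟨ζ₀ ^ t, ⟨n, hnu, by rw [← pow_mul, mul_comm, pow_mul, hζ₀n, one_pow]⟩, ?_⟩
  have hxnc : x ^ (n * c) - 1 ∈ maximalIdeal R := by
    refine residue_eq_one_of_pow_prime_pow I hp hpI (s := s) ?_
    rw [← pow_mul, mul_assoc, mul_comm c, ← mul_assoc, mul_comm n, hΦsn, pow_mul]
    exact hI𝔪 ((sub_dvd_pow_sub_pow (x ^ Φ) 1 c |> fun h => by rw [one_pow] at h; exact (mem_of_dvd_of_mem' h hxΦ)))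
  have e : ζ₀ ^ t - x = (ζ₀ ^ t - y ^ t) + x * (x ^ (n * c) - 1) := by
    rw [hy, ← pow_mul, hpst, pow_succ, mul_sub, mul_one, mul_comm (x ^ (n * c)) x]; ring
  rw [e]
  exact Ideal.add_mem _ (hI𝔪 (mem_of_dvd_of_mem' (sub_dvd_pow_sub_pow ζ₀ y t) hζ₀y)) (Ideal.mul_mem_left _ _ hxnc)

end Existence

end Literature.RingTheory.CompleteLocalRings

end
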